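import Literature.NumberTheory.LFunctions.DirichletPrincipalDetector
import Literature.NumberTheory.LFunctions.KhaleLemma62
import HarnessLib

/-!
# Khale 2024, Lemmas 5.2 and 6.2 for the principal character `χ₀` modulo `q`

Topic `Literature/NumberTheory/LFunctions`.  Everything in this file is PROVED; no definition, no
named fact.  T. Khale, *An explicit Vinogradov–Korobov zero-free region for Dirichlet
L-functions*, Q. J. Math. 75 (2024) = arXiv:2210.06457v1, states Lemmas 5.2, 6.2, 6.3 for EVERY
character `χ` (mod `q`); (8.2) applies them to the powers `χ^j` of a primitive character, among
which the principal character `χ₀` occurs (`δ(χ) = 1`).  The tree's `KhaleL52.lemma52`,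
`KhaleL62.lemma62`, `KhaleL63.lemma63` are for `χ ≠ χ₀`; here are the companions for
`χ₀` (`L(s, χ₀) = ζ(s) ∏_{p ∣ q}(1 − p^{−s})`, Mathlib's `LFunctionTrivChar`), built on the
principal detector `PrincipalDetector.ford_zero_detector_trivChar` (which keeps the pole term
`(σ − 1)/|s − 1|² ≥ 0` that the source, like Ford's Lemma 4.1, drops silently):

* `KhalePrincipal.lemma52_triv` — **Lemma 5.2 for `χ₀`** (the generic engine
  `KhaleL52.integral_div_cosh_sq_le_generic`; the window `|y| < 3` is bounded through
  `log|ζ| ≤ log(1/(1−σ) + 4) ∨ |ζ| ≤ 6` (the tree's `FordL34` lemmas) and `|log|∏(1 − p^{−s})|| ≤ 2ω(q) ≤ 4 log q`);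
* `KhalePrincipal.lemma62_triv` — **Lemma 6.2 for `χ₀`, every `η ∈ (0, 3/4)`**, with the pole
  term: `−Re L'/L(s, χ₀) ≤ (σ−1)/|s−1|² + Σ_{ρ∈S} m(ρ) Re h_η(ρ − s) + (1/2η)(…) − (1/4η)∫ log|L(s+η+2ηiu/π, χ₀)|/cosh²u du`
  (`S` a finite set of zeros of `ζ` with `Re ρ ≥ σ − η`, `m = riemannZetaZeroOrder`);
* Lemma 6.3 for `χ₀` is in the sibling file `KhalePrincipal63.lean`.

## References

* T. Khale, arXiv:2210.06457v1, Lemmas 5.2, 6.2, 6.3 (`δ(χ) = 1`). [Khale2024]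
* K. Ford, *Zero-free regions for the Riemann zeta function* (2002), Lemmas 3.4, 4.1, 4.2. [Ford2002Millennium]
-/

noncomputable section

open Complex Set Metric Filter Topology MeasureTheory Real
open Literature.Analysis.Complex Literature.Analysis.Complex.FordDetector

namespace Literature.NumberTheory.LFunctions

namespace KhalePrincipal

open FordL34 PrincipalDetector

variable {q : ℕ} [NeZero q]

/-! ### `ω(q) ≤ 2 log q` and the window bound for `L(s, χ₀)` -/

omit [NeZero q] in
/-- `ω(q) log 2 ≤ log q` (`2^{ω(q)} ≤ ∏_{p∣q} p ≤ q`), hence `ω(q) ≤ 2 log q`, for `q ≥ 1`. [folklore] -/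
theorem card_primeFactors_le (hq : 1 ≤ q) : (q.primeFactors.card : ℝ) ≤ 2 * Real.log q := by
  have h1 : 2 ^ q.primeFactors.card ≤ ∏ p ∈ q.primeFactors, p :=
    Finset.pow_card_le_prod _ _ 2 fun p hp ↦ (Nat.prime_of_mem_primeFactors hp).two_le
  have h2 : ∏ p ∈ q.primeFactors, p ≤ q := Nat.le_of_dvd hq (Nat.prod_primeFactors_dvd q)
  have h3 : (2 : ℝ) ^ q.primeFactors.card ≤ q := by exact_mod_cast h1.trans h2
  have h4 := Real.log_le_log (by positivity) h3
  rw [Real.log_pow] at h4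
  have hlog2 := Real.log_two_gt_d9
  have hlogq : 0 ≤ Real.log (q : ℝ) := Real.log_natCast_nonneg q
  nlinarith

/-- **The window `|y| < 3` for `χ₀`**: for `1/2 ≤ σ < 1` and `|y| < 3`,
`log|L(σ + iy, χ₀)| ≤ 4 log q + log(1/(1 − σ) + 4) + log 6`
(`L = ζ ∏(1 − p^{−s})`, `|log|∏|| ≤ 2ω(q)`, the tree's near-axis bounds for `ζ`; a zero of `ζ` gives
`log 0 = 0`). [cite: Khale2024, Lemma 5.2 (proof, Case 1, principal character)] -/
theorem log_norm_trivChar_le_near {σ : ℝ} (hσ : 1 / 2 ≤ σ) (hσ1 : σ < 1) {y : ℝ} (hy : |y| < 3) :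
    Real.log ‖DirichletCharacter.LFunctionTrivChar q (σ + y * I)‖ ≤
      4 * Real.log q + Real.log (1 / (1 - σ) + 4) + Real.log 6 := by
  have hq : 1 ≤ q := NeZero.one_le
  set s : ℂ := (σ : ℂ) + y * I with hs
  have hs1 : s ≠ 1 := by
    intro h; have := congrArg Complex.re h; simp [hs] at this; linarith
  have hsre : s.re = σ := by simp [hs]
  have h1σ : 0 < 1 - σ := by linarith
  have hA : 0 ≤ Real.log (1 / (1 - σ) + 4) := Real.log_nonneg (by
    have : 0 < 1 / (1 - σ) := by positivity
    linarith)
  have h6 : 0 ≤ Real.log (6 : ℝ) := Real.log_nonneg (by norm_num)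
  have hlogq : 0 ≤ Real.log (q : ℝ) := Real.log_natCast_nonneg q
  by_cases hζ : riemannZeta s = 0
  · rw [LFunctionTrivChar_eq q hs1, hζ, mul_zero, norm_zero, Real.log_zero]
    positivity
  rw [LFunctionTrivChar_eq q hs1, norm_mul,
    Real.log_mul (norm_ne_zero_iff.2 (eulerProd_ne_zero q (by rw [hsre]; linarith))) (norm_ne_zero_iff.2 hζ)]
  have hg : Real.log ‖DirichletSegments.eulerFactor q s‖ ≤ 4 * Real.log q := by
    have h1 := abs_log_norm_eulerProd_le q (s := s) (by rw [hsre]; linarith)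
    have h2 := card_primeFactors_le hq
    have := le_abs_self (Real.log ‖DirichletSegments.eulerFactor q s‖)
    linarith
  have hz : Real.log ‖riemannZeta s‖ ≤ Real.log (1 / (1 - σ) + 4) + Real.log 6 := by
    rcases lt_or_ge |y| 1 with h1 | h1
    · have := log_norm_zeta_le_near_of_lt_one hσ hσ1 h1
      simp only [hs]; linarith
    · have hb := norm_zeta_le_six hσ hσ1.le h1 hy.le
      have := log_norm_le_log (by norm_num) hb
      simp only [hs]; linarith
  linarith

/-- **Numerical side condition 1 for the window constant `K = 500000 log t + 5`** (`t ≥ e^{1938}`,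
`0 < a ≤ 1/2`). [cite: Khale2024, Lemma 5.2 (proof)] -/
theorem numerics_window₁_triv {a t : ℝ} (ha : 0 < a) (ha2 : a ≤ 1 / 2) (ht : Real.exp 1938 ≤ t) :
    (500000 * Real.log t + 5) *
        ((4 * Real.exp (-(2 * |(-((1 - 1 / 100) * t) / a)|))) *
          (-((1 - 1 / 100) * t) / a - -((1 + 1 / 100) * t) / a))
      ≤ 1 / (10 * Real.log t) * (a ^ 2 / (24 * t ^ 2)) := by
  have ht6 : (10 : ℝ) ^ 6 ≤ t := KhaleL52.exp_1938_ge.trans ht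
  have h6 : (10 : ℝ) ^ 6 = 1000000 := by norm_num
  have ht0 : 0 < t := by linarith
  have hℓ1 : 1 ≤ Real.log t := by
    rw [← Real.log_exp 1]
    refine Real.log_le_log (Real.exp_pos 1) ?_
    have := Real.exp_one_lt_d9
    linarith
  have hℓ0 : 0 ≤ Real.log t := by linarith
  have hw := KhaleL52.window_weight_le (a := a) ha ht0
  set v : ℝ := t / a with hv
  have hv0 : 0 < v := div_pos ht0 ha
  have hvt : 2 * t ≤ v := by
    rw [hv, le_div_iff₀ ha]; nlinarith
  have hK0 : 0 ≤ 500000 * Real.log t + 5 := by positivity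
  refine (mul_le_mul_of_nonneg_left hw hK0).trans ?_
  have ha2' : a ^ 2 / (24 * t ^ 2) = 1 / (24 * v ^ 2) := by
    simp only [hv]; field_simp
  rw [ha2', show (500000 * Real.log t + 5) * (58 / v ^ 5) = (500000 * Real.log t + 5) * 58 / v ^ 5 by ring,
    show 1 / (10 * Real.log t) * (1 / (24 * v ^ 2)) = 1 / (240 * Real.log t * v ^ 2) by
      field_simp; ring]
  rw [div_le_div_iff₀ (by positivity) (by positivity)]
  have hℓ : Real.log t ≤ 2 * t ^ (1 / 2 : ℝ) := by
    have := Real.log_le_rpow_div ht0.le (by norm_num : (0 : ℝ) < 1 / 2)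
    linarith
  have hsq : (t ^ (1 / 2 : ℝ)) ^ 2 = t := by
    rw [← Real.rpow_natCast, ← Real.rpow_mul ht0.le]; norm_num
  have hrt : 0 ≤ t ^ (1 / 2 : ℝ) := by positivity
  have h1 : (500000 * Real.log t + 5) ≤ 500005 * Real.log t := by linarith
  have h2 : Real.log t ^ 2 ≤ 4 * t := by nlinarith
  have hv3 : (2 * t) ^ 3 ≤ v ^ 3 := pow_le_pow_left₀ (by linarith) hvt 3
  calc (500000 * Real.log t + 5) * 58 * (240 * Real.log t * v ^ 2)
      = 13920 * ((500000 * Real.log t + 5) * Real.log t) * v ^ 2 := by ring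
    _ ≤ 13920 * (500005 * Real.log t * Real.log t) * v ^ 2 := by gcongr
    _ = 6960069600 * Real.log t ^ 2 * v ^ 2 := by ring
    _ ≤ 6960069600 * (4 * t) * v ^ 2 := by gcongr
    _ ≤ v ^ 3 * v ^ 2 := by
        refine mul_le_mul_of_nonneg_right ?_ (by positivity)
        have : 6960069600 * (4 * t) ≤ (2 * t) ^ 3 := by nlinarith
        linarith
    _ = 1 * v ^ 5 := by ring

/-! ### Lemma 5.2 for `χ₀` -/

/-- **Khale 2024, Lemma 5.2 for the principal character.** Assume (2.4) (`HasHurwitzFordBound A B`,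
`A, B > 0`). Let `q ≥ 3`, `σ ∈ [1/2, 1)`, `a ∈ (0, 1/2]`, and (5.1): `1 − σ ≥ 1.92 (log(t/100))^{−2/3}`,
`t ≥ q^{1/100000}`, `t ≥ e^{1938}`. Then
`∫ log|L(σ + it + iau, χ₀)|/cosh²u du ≤ 2(log(A+1) + (1−σ) log q + B(1−σ)^{3/2} log t + ⅔ log log t)`.
[cite: Khale2024, Lemma 5.2] -/
theorem lemma52_triv {A B : ℝ} (hA : 0 < A) (hB : 0 < B) (hF : HasHurwitzFordBound A B)
    (hq : 3 ≤ q) {σ a t : ℝ} (hσ : 1 / 2 ≤ σ) (hσ1 : σ < 1) (ha : 0 < a) (ha2 : a ≤ 1 / 2)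
    (h51a : 1.92 * Real.log (t / 100) ^ (-(2 / 3 : ℝ)) ≤ 1 - σ)
    (h51b : (q : ℝ) ^ (1 / 100000 : ℝ) ≤ t) (h51c : Real.exp 1938 ≤ t) :
    ∫ u : ℝ, Real.log ‖DirichletCharacter.LFunctionTrivChar q ((σ : ℂ) + ((t + u * a : ℝ) : ℂ) * I)‖ / Real.cosh u ^ 2 ≤
      2 * (Real.log (A + 1) + (1 - σ) * Real.log q + B * (1 - σ) ^ (3 / 2 : ℝ) * Real.log t
        + 2 / 3 * Real.log (Real.log t)) := by
  have ht6 : (10 : ℝ) ^ 6 ≤ t := KhaleL52.exp_1938_ge.trans h51c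
  have ht100 : (100 : ℝ) < t := by linarith [show (100 : ℝ) < 10 ^ 6 by norm_num]
  have ht0 : 0 < t := by linarith
  have hq1 : 1 ≤ q := le_trans (by norm_num) hq
  have hq1' : (1 : ℝ) ≤ q := by exact_mod_cast hq1
  have hq0 : (0 : ℝ) < q := by linarith
  set Y : ℝ := B * (1 - σ) ^ (3 / 2 : ℝ) with hY
  have hY0 : 0 ≤ Y := by positivity
  set LX : ℝ := Real.log (A + 1) + (1 - σ) * Real.log q with hLX
  have hLA : 0 ≤ Real.log (A + 1) := Real.log_nonneg (by linarith)
  have hσq : 0 ≤ (1 - σ) * Real.log q := mul_nonneg (by linarith) (Real.log_nonneg hq1')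
  have hLX0 : 0 ≤ LX := by simp only [hLX]; linarith
  have hlt100 : 0 < Real.log (t / 100) := Real.log_pos (by rw [lt_div_iff₀ (by norm_num)]; linarith)
  have hD : 1.92 / (1 - σ) ≤ Real.log (t / 100) ^ (2 / 3 : ℝ) := by
    have hpow : 0 < Real.log (t / 100) ^ (2 / 3 : ℝ) := Real.rpow_pos_of_pos hlt100 _
    rw [Real.rpow_neg hlt100.le, ← div_eq_mul_inv] at h51a
    rw [div_le_iff₀ (by linarith)]
    rw [div_le_iff₀ hpow] at h51a
    linarith
  have hlogq : Real.log q ≤ 100000 * Real.log t := by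
    have h1 : Real.log ((q : ℝ) ^ (1 / 100000 : ℝ)) ≤ Real.log t :=
      Real.log_le_log (Real.rpow_pos_of_pos hq0 _) h51b
    rw [Real.log_rpow hq0] at h1
    linarith
  have hℓ1 : 1 ≤ Real.log t := by
    rw [← Real.log_exp 1]
    exact Real.log_le_log (Real.exp_pos 1) (le_trans (by have := Real.exp_one_lt_d9; linarith) ht100.le)
  -- the envelope (Lemma 5.1 holds for every character, `χ₀` included)
  have hmain : ∀ T : ℝ, 3 ≤ T → ∀ y : ℝ, 1 / 100 * t ≤ |y| → |y| ≤ T →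
      (fun y : ℝ ↦ Real.log ‖DirichletCharacter.LFunctionTrivChar q ((σ : ℂ) + (y : ℂ) * I)‖) y ≤
        LX + Y * Real.log T + 2 / 3 * Real.log (Real.log T) := by
    intro T hT y hy1 hyT
    have hy3 : 3 ≤ |y| := le_trans (by linarith) hy1
    have hlogT : Real.log (t / 100) ≤ Real.log T :=
      Real.log_le_log (by positivity) (by linarith [hy1.trans hyT])
    have henv := KhaleL52.norm_LFunction_le_envelope hA.le hB.le hF hq (1 : DirichletCharacter ℂ q)
      hσ hσ1 ht100 hD hy3 hyT hlogT
    obtain ⟨h1, h2⟩ := KhaleL52.log_envelope_eq hA.le hq1 hσ1.le hY0 (σ := σ) (T := T) hT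
    have := log_norm_le_log h1 henv
    rw [h2] at this
    show Real.log ‖DirichletCharacter.LFunction (1 : DirichletCharacter ℂ q) ((σ : ℂ) + (y : ℂ) * I)‖ ≤ _
    simp only [hLX]
    linarith
  -- the window constant `K = 500000 log t + 5`
  have hK : 0 ≤ 500000 * Real.log t + 5 := by positivity
  have hwin : ∀ y : ℝ, |y| < 1 / 100 * t →
      (fun y : ℝ ↦ Real.log ‖DirichletCharacter.LFunctionTrivChar q ((σ : ℂ) + (y : ℂ) * I)‖) y ≤
        LX + Y * Real.log t + 2 / 3 * Real.log (Real.log t) + (500000 * Real.log t + 5) := by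
    intro y hy
    have hM : 0 ≤ Y * Real.log t + 2 / 3 * Real.log (Real.log t) := by
      have := mul_nonneg hY0 (by linarith : 0 ≤ Real.log t)
      have := Real.log_nonneg hℓ1
      positivity
    rcases lt_or_ge |y| 3 with h3 | h3
    · -- Case 1 of the source, principal character
      have hb := log_norm_trivChar_le_near (q := q) hσ hσ1 h3
      have h1σ : 0 < 1 - σ := by linarith
      have hlt : Real.log (t / 100) ≤ Real.log t :=
        Real.log_le_log (by positivity) (by rw [div_le_iff₀ (by norm_num)]; linarith)
      have h2 : Real.log (t / 100) ^ (2 / 3 : ℝ) ≤ Real.log t := by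
        rcases le_or_gt (Real.log (t / 100)) 1 with hle | hgt
        · calc Real.log (t / 100) ^ (2 / 3 : ℝ) ≤ (1 : ℝ) ^ (2 / 3 : ℝ) :=
                Real.rpow_le_rpow hlt100.le hle (by norm_num)
            _ = 1 := Real.one_rpow _
            _ ≤ Real.log t := hℓ1
        · calc Real.log (t / 100) ^ (2 / 3 : ℝ) ≤ Real.log (t / 100) ^ (1 : ℝ) :=
                Real.rpow_le_rpow_of_exponent_le hgt.le (by norm_num)
            _ = Real.log (t / 100) := Real.rpow_one _
            _ ≤ Real.log t := hlt
      have hinv : 1 / (1 - σ) ≤ Real.log t := by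
        rw [div_le_iff₀ h1σ]
        have hD' := hD
        rw [div_le_iff₀ h1σ] at hD'
        nlinarith [h2, h1σ]
      have hnear : Real.log (1 / (1 - σ) + 4) ≤ Real.log t + 3 := by
        have hpos : 0 < 1 / (1 - σ) + 4 := by positivity
        calc Real.log (1 / (1 - σ) + 4) ≤ Real.log (Real.log t + 4) := Real.log_le_log hpos (by linarith)
          _ ≤ Real.log t + 3 := by
              have := Real.log_le_sub_one_of_pos (by linarith : 0 < Real.log t + 4); linarith
      have h6 : Real.log 6 ≤ 2 := by
        have h62 : Real.log 6 ≤ Real.log (Real.exp 1 * Real.exp 1) := by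
          refine Real.log_le_log (by norm_num) ?_
          have := Real.exp_one_gt_d9; nlinarith
        rw [Real.log_mul (Real.exp_pos 1).ne' (Real.exp_pos 1).ne', Real.log_exp] at h62
        linarith
      show Real.log ‖DirichletCharacter.LFunctionTrivChar q ((σ : ℂ) + (y : ℂ) * I)‖ ≤ _
      simp only [hLX]
      linarith [hb, hinv, hnear, h6, hlogq, hM, hLA, hσq, hℓ1]
    · -- Case 2 of the source: Lemma 5.1 at `T = t`
      have hyt : |y| ≤ t := by linarith
      have henv := KhaleL52.norm_LFunction_le_envelope hA.le hB.le hF hq (1 : DirichletCharacter ℂ q)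
        hσ hσ1 ht100 hD h3 hyt (Real.log_le_log (by positivity) (by linarith))
      obtain ⟨h1, h2⟩ := KhaleL52.log_envelope_eq hA.le hq1 hσ1.le hY0 (σ := σ) (T := t) (by linarith)
      have := log_norm_le_log h1 henv
      rw [h2] at this
      show Real.log ‖DirichletCharacter.LFunction (1 : DirichletCharacter ℂ q) ((σ : ℂ) + (y : ℂ) * I)‖ ≤ _
      simp only [hLX]
      linarith
  have key := KhaleL52.integral_div_cosh_sq_le_generic
    (f := fun y : ℝ ↦ Real.log ‖DirichletCharacter.LFunctionTrivChar q ((σ : ℂ) + (y : ℂ) * I)‖)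
    (LX := LX) (Y := Y) (Z := 2 / 3) (a := a) (t := t) (θ := 1 / 100) (K := 500000 * Real.log t + 5)
    hLX0 hY0 (by norm_num) (by linarith) ha ha2 (by linarith) (by norm_num) (by linarith)
    hmain hK hwin (numerics_window₁_triv ha ha2 h51c) (KhaleL52.numerics_window₂ ha ha2 h51c)
  have e : LX + Y * Real.log t + 2 / 3 * Real.log (Real.log t) =
      Real.log (A + 1) + (1 - σ) * Real.log q + B * (1 - σ) ^ (3 / 2 : ℝ) * Real.log t
        + 2 / 3 * Real.log (Real.log t) := by simp only [hLX, hY]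
  rw [e] at key
  exact key

/-! ### Lemma 6.2 for `χ₀` -/

/-- **Khale 2024, Lemma 6.2 for `χ₀`, good `η`** (no zero of `ζ` on `Re z = σ − η`), with the pole
term kept.  Hypotheses as in `KhaleL62.lemma62_of_good`; `S` a finite set of zeros of `ζ` with
`Re ρ > σ − η`. [cite: Khale2024, Lemma 6.2] -/
theorem lemma62_triv_of_good {A B : ℝ} (hA : 0 < A) (hB : 0 < B) (hF : HasHurwitzFordBound A B)
    (hq : 3 ≤ q) {σ t η : ℝ} (ht : Real.exp 1938 ≤ t)
    (htq : (q : ℝ) ^ (1 / 100000 : ℝ) ≤ t) (hη : 0 < η) (hη34 : η ≤ 3 / 4)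
    (hleft : 1 / 2 ≤ σ - η) (hσ : 1 ≤ σ)
    (hσ' : σ ≤ 1 + η - 1.92 * Real.log (t / 100) ^ (-(2 / 3 : ℝ))) (hright : σ + η ≤ 3)
    (hgood : ∀ ρ : ℂ, riemannZeta ρ = 0 → ρ.re ≠ σ - η)
    (S : Finset ℂ) (hS : ∀ ρ ∈ S, riemannZeta ρ = 0 ∧ σ - η < ρ.re) :
    -(deriv (DirichletCharacter.LFunctionTrivChar q) (σ + t * I) /
        DirichletCharacter.LFunctionTrivChar q (σ + t * I)).re ≤
      (σ - 1) / ‖(σ : ℂ) + t * I - 1‖ ^ 2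
      + (∑ ρ ∈ S, (riemannZetaZeroOrder ρ : ℝ) * (fordCot η (ρ - (σ + t * I))).re)
      + 1 / (2 * η) * ((1 - σ + η) * Real.log q + 2 / 3 * Real.log (Real.log t)
          + B * (1 - σ + η) ^ (3 / 2 : ℝ) * Real.log t + Real.log (A + 1))
      - 1 / (4 * η) * ∫ u : ℝ, Real.log ‖DirichletCharacter.LFunctionTrivChar q
          ((σ + η : ℝ) + ((t + u * (2 * η / π) : ℝ) : ℂ) * I)‖ / Real.cosh u ^ 2 := by
  have ht6 : (10 : ℝ) ^ 6 ≤ t := KhaleL52.exp_1938_ge.trans ht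
  have h6 : (10 : ℝ) ^ 6 = 1000000 := by norm_num
  have ht0 : t ≠ 0 := by intro h; rw [h] at ht6; linarith
  have h := ford_zero_detector_trivChar q (t := t) hη hσ hleft hright ht0 hgood S hS
  have ha : 0 < 2 * η / π := by positivity
  have ha2 : 2 * η / π ≤ 1 / 2 := by
    rw [div_le_iff₀ Real.pi_pos]
    have := Real.pi_gt_three
    nlinarith
  have hpow : 0 < 1.92 * Real.log (t / 100) ^ (-(2 / 3 : ℝ)) := by
    have : 0 < Real.log (t / 100) := Real.log_pos (by
      rw [lt_div_iff₀ (by norm_num)]; nlinarith)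
    positivity
  have hσ1 : σ - η < 1 := by linarith
  have h51a : 1.92 * Real.log (t / 100) ^ (-(2 / 3 : ℝ)) ≤ 1 - (σ - η) := by linarith
  have hL := lemma52_triv (q := q) hA hB hF hq (σ := σ - η) (a := 2 * η / π) (t := t)
    hleft hσ1 ha ha2 h51a htq ht
  rw [show 1 - (σ - η) = 1 - σ + η by ring] at hL
  have hη4 : 0 < 1 / (4 * η) := by positivity
  have key := mul_le_mul_of_nonneg_left hL hη4.le
  have e : 1 / (4 * η) * (2 * (Real.log (A + 1) + (1 - σ + η) * Real.log q
      + B * (1 - σ + η) ^ (3 / 2 : ℝ) * Real.log t + 2 / 3 * Real.log (Real.log t)))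
      = 1 / (2 * η) * ((1 - σ + η) * Real.log q + 2 / 3 * Real.log (Real.log t)
          + B * (1 - σ + η) ^ (3 / 2 : ℝ) * Real.log t + Real.log (A + 1)) := by
    field_simp; ring
  rw [e] at key
  rw [mul_sub] at h
  linarith

/-- The zeros of `ζ` with `Re ρ ≥ 1/4` form a countable set (each disc `|1 + in − ρ| ≤ 1`, `n ∈ ℤ`,
contains finitely many, `fordNearZeroSet_finite`). [folklore] -/
theorem countable_zetaZeros_quarter : {ρ : ℂ | riemannZeta ρ = 0 ∧ 1 / 4 ≤ ρ.re}.Countable := by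
  have h : {ρ : ℂ | riemannZeta ρ = 0 ∧ 1 / 4 ≤ ρ.re} ⊆ ⋃ n : ℤ, fordNearZeroSet n 1 := by
    rintro ρ ⟨h0, hre⟩
    have hre1 : ρ.re < 1 := by
      by_contra hle
      exact riemannZeta_ne_zero_of_one_le_re (not_lt.1 hle) h0
    refine mem_iUnion.2 ⟨round ρ.im, h0, ?_⟩
    have him : |(round ρ.im : ℝ) - ρ.im| ≤ 1 / 2 := by
      have := abs_sub_round ρ.im
      rwa [abs_sub_comm] at this
    rw [← sq_le_one_iff₀ (norm_nonneg _), Complex.sq_norm, Complex.normSq_apply]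
    simp only [sub_re, add_re, one_re, mul_re, I_re, mul_zero, I_im, mul_one,
      sub_self, add_zero, sub_im, add_im, one_im, mul_im, zero_add, Complex.ofReal_intCast,
      Complex.intCast_re, Complex.intCast_im]
    rw [abs_le] at him
    nlinarith
  exact (countable_iUnion fun n : ℤ ↦ (fordNearZeroSet_finite (n : ℝ) 1).countable).mono h

/-- Good `η'` for `ζ` arbitrarily close to `η⁺`: for `ε > 0` there is `η' ∈ (η, η + ε)` with no zero
`ρ` of `ζ`, `Re ρ ≥ 1/4`, on `Re z = σ − η'`. [folklore] -/
theorem exists_good_eta_zeta (σ η : ℝ) {ε : ℝ} (hε : 0 < ε) :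
    ∃ η' : ℝ, η < η' ∧ η' < η + ε ∧ ∀ ρ : ℂ, riemannZeta ρ = 0 → 1 / 4 ≤ ρ.re → ρ.re ≠ σ - η' := by
  set Bad : Set ℝ := (fun ρ : ℂ ↦ σ - ρ.re) '' {ρ : ℂ | riemannZeta ρ = 0 ∧ 1 / 4 ≤ ρ.re} with hBad
  have hcount : Bad.Countable := countable_zetaZeros_quarter.image _
  have hT : ¬ (Ioo η (η + ε) ⊆ Bad) := by
    intro hsub
    have h0 : volume (Ioo η (η + ε)) = 0 := measure_mono_null hsub (hcount.measure_zero volume)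
    rw [Real.volume_Ioo] at h0
    have : ENNReal.ofReal (η + ε - η) ≠ 0 := by
      rw [ENNReal.ofReal_ne_zero_iff]; linarith
    exact this h0
  obtain ⟨η', hη'T, hη'B⟩ := not_subset.1 hT
  refine ⟨η', hη'T.1, hη'T.2, fun ρ hρ hre14 hre ↦ hη'B ⟨ρ, ⟨hρ, hre14⟩, ?_⟩⟩
  simp only
  rw [hre]; ring

/-- **Continuity in `η` of the right-line integral for `χ₀`** (as `KhaleL62.tendsto_integral_right`).
[folklore] -/
theorem tendsto_integral_right_triv {σ t η₀ : ℝ} (hσ : 1 ≤ σ) (hη₀ : 0 < η₀) {ηs : ℕ → ℝ}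
    (hηge : ∀ n, η₀ ≤ ηs n) (hη : Tendsto ηs atTop (𝓝 η₀)) :
    Tendsto (fun n ↦ ∫ u : ℝ, Real.log ‖DirichletCharacter.LFunctionTrivChar q ((σ + ηs n : ℝ) +
        ((t + u * (2 * ηs n / π) : ℝ) : ℂ) * I)‖ / Real.cosh u ^ 2) atTop
      (𝓝 (∫ u : ℝ, Real.log ‖DirichletCharacter.LFunctionTrivChar q ((σ + η₀ : ℝ) +
        ((t + u * (2 * η₀ / π) : ℝ) : ℂ) * I)‖ / Real.cosh u ^ 2)) := by
  set M : ℝ := 3 / 2 * ∑' p : Nat.Primes, (p : ℝ) ^ (-(1 + η₀)) with hM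
  -- continuity of `L(·, χ₀)` off `s = 1`
  have hptz : ∀ (z : ℂ), 1 < z.re →
      ContinuousAt (DirichletCharacter.LFunctionTrivChar q) z ∧ DirichletCharacter.LFunctionTrivChar q z ≠ 0 := by
    intro z hz
    have hz1 : z ≠ 1 := by intro h; rw [h] at hz; simp at hz
    exact ⟨(DirichletCharacter.differentiableAt_LFunction (1 : DirichletCharacter ℂ q) z (Or.inl hz1)).continuousAt,
      DirichletCharacter.LFunction_ne_zero_of_one_le_re (1 : DirichletCharacter ℂ q) (Or.inr hz1) hz.le⟩
  have hpt : ∀ (u : ℝ) {η : ℝ}, 0 < η →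
      ContinuousAt (fun η : ℝ ↦ Real.log ‖DirichletCharacter.LFunctionTrivChar q ((σ + η : ℝ) +
        ((t + u * (2 * η / π) : ℝ) : ℂ) * I)‖) η := by
    intro u η hη
    obtain ⟨hc, hne⟩ := hptz (((σ + η : ℝ) : ℂ) + ((t + u * (2 * η / π) : ℝ) : ℂ) * I) (by simp; linarith)
    have h1 : ContinuousAt (fun η : ℝ ↦ DirichletCharacter.LFunctionTrivChar q (((σ + η : ℝ) : ℂ) +
        ((t + u * (2 * η / π) : ℝ) : ℂ) * I)) η :=
      hc.comp (f := fun η : ℝ ↦ ((σ + η : ℝ) : ℂ) + ((t + u * (2 * η / π) : ℝ) : ℂ) * I) (by fun_prop)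
    exact (h1.norm).log (norm_ne_zero_iff.2 hne)
  refine tendsto_integral_filter_of_dominated_convergence (fun u ↦ M * (1 / Real.cosh u ^ 2)) ?_ ?_ ?_ ?_
  · refine Eventually.of_forall fun n ↦ ?_
    refine (Continuous.div ?_ (by fun_prop) fun u ↦ (pow_pos (Real.cosh_pos u) 2).ne').aestronglyMeasurable
    refine continuous_iff_continuousAt.2 fun u ↦ ?_
    have hn := hηge n
    obtain ⟨hc, hne⟩ := hptz (((σ + ηs n : ℝ) : ℂ) + ((t + u * (2 * ηs n / π) : ℝ) : ℂ) * I) (by simp; linarith)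
    have h1 : ContinuousAt (fun u : ℝ ↦ DirichletCharacter.LFunctionTrivChar q (((σ + ηs n : ℝ) : ℂ) +
        ((t + u * (2 * ηs n / π) : ℝ) : ℂ) * I)) u :=
      hc.comp (f := fun u : ℝ ↦ ((σ + ηs n : ℝ) : ℂ) + ((t + u * (2 * ηs n / π) : ℝ) : ℂ) * I) (by fun_prop)
    exact (h1.norm).log (norm_ne_zero_iff.2 hne)
  · refine Eventually.of_forall fun n ↦ ae_of_all _ fun u ↦ ?_
    rw [Real.norm_eq_abs, abs_div, abs_of_pos (pow_pos (Real.cosh_pos u) 2), div_eq_mul_one_div]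
    refine mul_le_mul_of_nonneg_right ?_ (by positivity)
    exact KhaleL62.abs_log_norm_LFunction_le_of_le (1 : DirichletCharacter ℂ q) (by linarith)
      (by simp; linarith [hηge n])
  · exact (Literature.Analysis.SpecialFunctions.integrable_inv_cosh_sq).const_mul M
  · refine ae_of_all _ fun u ↦ ?_
    have h := (hpt u hη₀).tendsto.comp hη
    simpa [Function.comp_def] using h.div_const (Real.cosh u ^ 2)

/-- **Khale 2024, Lemma 6.2 for the principal character, every `η`** (with the pole term
`(σ − 1)/|s − 1|² ≥ 0` kept, which the source drops): assume (2.4), `q ≥ 3`, `t ≥ e^{1938}`,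
`t ≥ q^{1/100000}`, `0 < η < 3/4`, `σ − η > 1/2`, `1 ≤ σ ≤ 1 + η − 1.92(log(t/100))^{−2/3}`, `σ + η ≤ 5/2`,
and `S` a finite set of zeros of `ζ` with `Re ρ ≥ σ − η`. Then
`−Re L'/L(s, χ₀) ≤ (σ−1)/|s−1|² + Σ_{ρ∈S} m(ρ) Re h_η(ρ − s) + (1/2η)((1−σ+η) log q + ⅔ log log t + B(1−σ+η)^{3/2} log t + log(A+1))`
`  − (1/4η) ∫ log|L(σ + η + i(t + 2ηu/π), χ₀)|/cosh²u du`. [cite: Khale2024, Lemma 6.2] -/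
theorem lemma62_triv {A B : ℝ} (hA : 0 < A) (hB : 0 < B) (hF : HasHurwitzFordBound A B)
    (hq : 3 ≤ q) {σ t η : ℝ} (ht : Real.exp 1938 ≤ t)
    (htq : (q : ℝ) ^ (1 / 100000 : ℝ) ≤ t) (hη : 0 < η) (hη34 : η < 3 / 4)
    (hleft : 1 / 2 < σ - η) (hσ : 1 ≤ σ)
    (hσ' : σ ≤ 1 + η - 1.92 * Real.log (t / 100) ^ (-(2 / 3 : ℝ))) (hright : σ + η ≤ 5 / 2)
    (S : Finset ℂ) (hS : ∀ ρ ∈ S, riemannZeta ρ = 0 ∧ σ - η ≤ ρ.re) :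
    -(deriv (DirichletCharacter.LFunctionTrivChar q) (σ + t * I) /
        DirichletCharacter.LFunctionTrivChar q (σ + t * I)).re ≤
      (σ - 1) / ‖(σ : ℂ) + t * I - 1‖ ^ 2
      + (∑ ρ ∈ S, (riemannZetaZeroOrder ρ : ℝ) * (fordCot η (ρ - (σ + t * I))).re)
      + 1 / (2 * η) * ((1 - σ + η) * Real.log q + 2 / 3 * Real.log (Real.log t)
          + B * (1 - σ + η) ^ (3 / 2 : ℝ) * Real.log t + Real.log (A + 1))
      - 1 / (4 * η) * ∫ u : ℝ, Real.log ‖DirichletCharacter.LFunctionTrivChar q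
          ((σ + η : ℝ) + ((t + u * (2 * η / π) : ℝ) : ℂ) * I)‖ / Real.cosh u ^ 2 := by
  set δ : ℝ := min (min (σ - η - 1 / 2) (3 / 4 - η)) (1 / 2) with hδ
  have hδ0 : 0 < δ := lt_min (lt_min (by linarith) (by linarith)) (by norm_num)
  have hδ1 : δ ≤ σ - η - 1 / 2 := (min_le_left _ _).trans (min_le_left _ _)
  have hδ2 : δ ≤ 3 / 4 - η := (min_le_left _ _).trans (min_le_right _ _)
  have hδ3 : δ ≤ 1 / 2 := min_le_right _ _
  have hch : ∀ n : ℕ, ∃ η' : ℝ, η < η' ∧ η' < η + δ / (n + 2) ∧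
      ∀ ρ : ℂ, riemannZeta ρ = 0 → 1 / 4 ≤ ρ.re → ρ.re ≠ σ - η' := fun n ↦
    exists_good_eta_zeta σ η (by positivity)
  choose ηs hη1 hη2 hgood using hch
  have hηle : ∀ n, ηs n ≤ η + δ / 2 := fun n ↦ by
    have h1 := hη2 n
    have h2 : δ / (n + 2) ≤ δ / 2 := div_le_div_of_nonneg_left hδ0.le (by norm_num) (by
      have := (Nat.cast_nonneg n : (0 : ℝ) ≤ n); linarith)
    linarith
  have hη_tend : Tendsto ηs atTop (𝓝 η) := by
    have h0 : Tendsto (fun n : ℕ ↦ η + δ / ((n : ℝ) + 2)) atTop (𝓝 (η + 0)) :=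
      tendsto_const_nhds.add ((tendsto_const_nhds (x := δ)).div_atTop
        (tendsto_atTop_add_const_right atTop (2 : ℝ) tendsto_natCast_atTop_atTop))
    rw [add_zero] at h0
    exact tendsto_of_tendsto_of_tendsto_of_le_of_le tendsto_const_nhds h0 (fun n ↦ (hη1 n).le)
      (fun n ↦ (hη2 n).le)
  -- the inequality at `η_n`
  have hineq : ∀ n,
      -(deriv (DirichletCharacter.LFunctionTrivChar q) (σ + t * I) /
          DirichletCharacter.LFunctionTrivChar q (σ + t * I)).re ≤
        (σ - 1) / ‖(σ : ℂ) + t * I - 1‖ ^ 2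
        + (∑ ρ ∈ S, (riemannZetaZeroOrder ρ : ℝ) * (fordCot (ηs n) (ρ - (σ + t * I))).re)
        + 1 / (2 * ηs n) * ((1 - σ + ηs n) * Real.log q + 2 / 3 * Real.log (Real.log t)
            + B * (1 - σ + ηs n) ^ (3 / 2 : ℝ) * Real.log t + Real.log (A + 1))
        - 1 / (4 * ηs n) * ∫ u : ℝ, Real.log ‖DirichletCharacter.LFunctionTrivChar q ((σ + ηs n : ℝ) +
            ((t + u * (2 * ηs n / π) : ℝ) : ℂ) * I)‖ / Real.cosh u ^ 2 := by
    intro n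
    have h1 := hη1 n
    have h2 := hηle n
    have hgood' : ∀ ρ : ℂ, riemannZeta ρ = 0 → ρ.re ≠ σ - ηs n := by
      intro ρ hρ hre
      exact hgood n ρ hρ (by rw [hre]; linarith) hre
    exact lemma62_triv_of_good hA hB hF hq ht htq (by linarith) (by linarith) (by linarith) hσ
      (by linarith) (by linarith) hgood' S (fun ρ hρ ↦ ⟨(hS ρ hρ).1, by linarith [(hS ρ hρ).2]⟩)
  -- limits of the right-hand side
  have hZS : Tendsto (fun n ↦ ∑ ρ ∈ S, (riemannZetaZeroOrder ρ : ℝ) * (fordCot (ηs n) (ρ - (σ + t * I))).re)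
      atTop (𝓝 (∑ ρ ∈ S, (riemannZetaZeroOrder ρ : ℝ) * (fordCot η (ρ - (σ + t * I))).re)) := by
    refine tendsto_finsetSum _ fun ρ hρ ↦ ?_
    obtain ⟨h0, hre⟩ := hS ρ hρ
    have hlt : ρ.re < 1 := by
      by_contra hle
      exact riemannZeta_ne_zero_of_one_le_re (not_lt.1 hle) h0
    have hw : ρ - (σ + t * I) ≠ 0 := by
      intro h
      have := congrArg Complex.re h
      simp at this
      linarith
    have hwre : |(ρ - (σ + t * I)).re| < 2 * η := by
      have e : (ρ - (σ + t * I)).re = ρ.re - σ := by simp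
      rw [e, abs_lt]; constructor <;> linarith
    exact ((KhaleL62.continuousAt_re_fordCot hη hw hwre).tendsto.comp hη_tend).const_mul _
  have hE : Tendsto (fun n ↦ 1 / (2 * ηs n) * ((1 - σ + ηs n) * Real.log q
        + 2 / 3 * Real.log (Real.log t) + B * (1 - σ + ηs n) ^ (3 / 2 : ℝ) * Real.log t
        + Real.log (A + 1))) atTop
      (𝓝 (1 / (2 * η) * ((1 - σ + η) * Real.log q + 2 / 3 * Real.log (Real.log t)
        + B * (1 - σ + η) ^ (3 / 2 : ℝ) * Real.log t + Real.log (A + 1)))) := by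
    have hr : Continuous fun x : ℝ ↦ (1 - σ + x) ^ (3 / 2 : ℝ) :=
      (Real.continuous_rpow_const (by norm_num)).comp (by fun_prop)
    have h1 : Continuous fun x : ℝ ↦ (1 - σ + x) * Real.log q + 2 / 3 * Real.log (Real.log t)
        + B * (1 - σ + x) ^ (3 / 2 : ℝ) * Real.log t + Real.log (A + 1) :=
      ((((continuous_const.sub continuous_const).add continuous_id).mul continuous_const).add
        continuous_const).add ((continuous_const.mul hr).mul continuous_const) |>.add continuous_const
    have h2 : ContinuousAt (fun x : ℝ ↦ 1 / (2 * x)) η :=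
      ContinuousAt.div continuousAt_const (by fun_prop) (by positivity)
    have h3 : ContinuousAt (fun x : ℝ ↦ 1 / (2 * x) * ((1 - σ + x) * Real.log q
        + 2 / 3 * Real.log (Real.log t) + B * (1 - σ + x) ^ (3 / 2 : ℝ) * Real.log t
        + Real.log (A + 1))) η := h2.mul h1.continuousAt
    exact h3.tendsto.comp hη_tend
  have hI := tendsto_integral_right_triv (q := q) (t := t) hσ hη (fun n ↦ (hη1 n).le) hη_tend
  have hinv : Tendsto (fun n ↦ 1 / (4 * ηs n)) atTop (𝓝 (1 / (4 * η))) := by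
    have h2 : ContinuousAt (fun x : ℝ ↦ 1 / (4 * x)) η :=
      ContinuousAt.div continuousAt_const (by fun_prop) (by positivity)
    exact h2.tendsto.comp hη_tend
  have hR : Tendsto (fun n ↦
      (σ - 1) / ‖(σ : ℂ) + t * I - 1‖ ^ 2
        + (∑ ρ ∈ S, (riemannZetaZeroOrder ρ : ℝ) * (fordCot (ηs n) (ρ - (σ + t * I))).re)
        + 1 / (2 * ηs n) * ((1 - σ + ηs n) * Real.log q + 2 / 3 * Real.log (Real.log t)
            + B * (1 - σ + ηs n) ^ (3 / 2 : ℝ) * Real.log t + Real.log (A + 1))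
        - 1 / (4 * ηs n) * ∫ u : ℝ, Real.log ‖DirichletCharacter.LFunctionTrivChar q ((σ + ηs n : ℝ) +
            ((t + u * (2 * ηs n / π) : ℝ) : ℂ) * I)‖ / Real.cosh u ^ 2) atTop
      (𝓝 ((σ - 1) / ‖(σ : ℂ) + t * I - 1‖ ^ 2
        + (∑ ρ ∈ S, (riemannZetaZeroOrder ρ : ℝ) * (fordCot η (ρ - (σ + t * I))).re)
        + 1 / (2 * η) * ((1 - σ + η) * Real.log q + 2 / 3 * Real.log (Real.log t)
            + B * (1 - σ + η) ^ (3 / 2 : ℝ) * Real.log t + Real.log (A + 1))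
        - 1 / (4 * η) * ∫ u : ℝ, Real.log ‖DirichletCharacter.LFunctionTrivChar q ((σ + η : ℝ) +
            ((t + u * (2 * η / π) : ℝ) : ℂ) * I)‖ / Real.cosh u ^ 2)) :=
    ((tendsto_const_nhds.add hZS).add hE).sub (hinv.mul hI)
  exact ge_of_tendsto' hR hineq

end KhalePrincipal

end Literature.NumberTheory.LFunctions
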